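import Summits.QuantumFields.YangMills.Theorems.BalabanUVNodesN22GenStepRecursion

/-!
# BalabanUVNodes ∕ node N22 = NE9 — THE GENERATOR-LEVEL RECURSION-CURRENCY EDITION AT THE RECORD: K3's `h9`, the kernel-face socket and the pin face from node N18's kernel
# step rate + ONE-STEP-MAP SCHEMAS on node00-def-W1's GENERATOR TOWERS `Gn K` (first- and second-order Lipschitz structure of the single map
# `(g_k, (E^{(j)})_{j≤k}) ↦ E^{(k+1)}(X; ·)` of [I] (2.13) on an admissibility domain) read at the run towers of record `truncRun K (toClusterTower (Gn K))` + the printed-type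
# output bound + readings ∕ tails ∕ W1-20's law ∕ (1.21) — «J52 AT THE GENERATED RUN TOWERS» (the analogue of module J44 for the recursion currency)

Cell `pub-ymgap`, HUMAN RULING D-0062 (Track A), R134 seat `pub-ymgap-dag-n22-c` (strategy s1), generation 17, module J54.  THEOREMS ONLY (no `def`, no `sorry`, standard axioms);
`--kind proof --supports stmt-QuantumFields-27366 --as helper` (K3⁸ `SpineGivenEndpointR13SepCoPHV`, skeleton v6 — §2b N22 face `h9` verbatim), COUNT-NEUTRAL.  Imports module J53
`…N22GenStepRecursion` (`termSecondDiffAt_box_truncRun_toClusterTower_of_genStepRecursion`; through it J51, J52, J49 §2 and dag-n22-w3's faces).  Nothing re-declared; the three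
theorems are ONE application each (module J52's three proofs with the term-level letter supplied by J53 at every torus).

WHY.  Module J52 asks the step schemas (T1)∕(T2-last)∕(T2-old) on the TERMS of abstract towers `S K` — quantified over pairs of coupling histories.  On def-W1's generated run towers
`S K := truncRun K (toClusterTower (Gn K))` (the run of `K` steps on torus `K`; def-W1 `runTowers`, module J44's convention) the terms are the iterates of ONE map per step, and module
J53 reduces the schemas to properties of that map: (G-T1) Lipschitz in (last coupling, older-term family) with the weighted linear channel `a`; (G-T2-last) second differences in the
last coupling; (G-T2-old) second order in the older-term family (channels `a`, `b`) — all on an admissibility domain `Adm K k` of older-term families, with (Adm-run) the generated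
families of window histories admissible ([I]'s inductive hypothesis (1.18) along the flow).  THIS FILE keys J52 to that currency:
* §1 ★★★ `ne9_EA_objectsOfRecord₁₃_of_kernelStepRate_genStepRecursion` — N18's `KernelStepRateOfRecord₁₃ F N θ κ₅ ℓ.θ₅ C₅`; per torus the generator schemas (G-T1) (`lam K k ≤ ℓ₁`),
  (G-T2-last) (`lam₂ K k ≤ ℓ₂`), (G-T2-old) with weights `0 ≤ a K k j ≤ c·ω₁^{k−j}`, `0 ≤ b K k j ≤ c_b·ω₁^{k−j}` (constants UNIFORM in `K`), (Adm-run); rows `ω₁ + c < ν`, `(ω₁+c)² ≤ ν`,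
  `1 ≤ ν`; the printed-type output bound, term holomorphy through the readings, chart ∕ space clauses, tails AT THE RUN TOWERS; W1-20's law
  `Localizes17OfRecord₁₃ F N θ (fun K => truncRun K (toClusterTower (Gn K))) emb`; (1.21); the letter rows with **`ℓ.θ₅·ν ≤ ℓ.ω²`** and the `C₉` row at `C₂(L₂)`,
  `L₂ = max ℓ₂ (c_b ℓ₁²∕(ν − ω₁ − c))` ⟹ **`NE9 ((objectsOfRecord₁₃ F N θ ℓ).EA 0) (Window θ.γ) ℓ.κ ℓ.moduli`**.
* §2 ★★★ `n22At_u3OfRecord₁₃_of_kernelStepRate_genStepRecursion` — the KERNEL-FACE SOCKET `∀ k, N22At (u3OfRecord₁₃ θ (objectsOfRecord₁₃ F N θ ℓ) k)` (dag-n27-c's `h22` row).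
* §3 ★★★ the pin face `n22At_rateCarriers_of_kernels_pin_of_kernelStepRate_genStepRecursion`.
THE N22 ROW SENTENCE in generator currency: «node N18's kernel step rate + first- and second-order Lipschitz structure of def-W1's ONE-STEP MAP {last coupling, older terms} ↦ new
term on every torus (weighted channels, admissibility domain, generated runs admissible) + (1.18) + readings + law + (1.21) ⟹ K3's `h9` with the record's GEOMETRIC moduli whenever
`θ₅·ν ≤ ω² < 1`».  Rows jointly satisfiable with `ℓ.Signs` iff `θ₅ν < 1` (J48 §5 at `q := ν`).

DISPLAYED INPUTS by owner.  N18's letter: node N18 (NE5 NOT PRINTED for d = 4).  (G-T1)∕(G-T2-last)∕(G-T2-old)∕(Adm-run): cell NEW-ESTIMATE SHAPES on def-W1's generator, NOT PRINTED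
(GAPS G-t4-U3-1∕-3; [I] prints the recursion (0.23) p. 256, (2.12)–(2.13) p. 268, the C^∞ clause p. 263 «(or analytic)», «vanishes at g_k = 0», «depends also on all preceding coupling
constants» p. 298 — no constants): node N10 ([II] Lemmas 1–3 differentiated in the older terms — inspection-level) ∕ NODE A on def-T's generator of record.  Output bound ∕ readings ∕
chart ∕ tails ∕ law: NODE A ∕ N09 ∕ def-W1 (towers NAMED by NODE A — trigger (t10)).  (1.21): dag-n22-w3's road.  The schemas are met by every generator ignoring `(t, old)` (A5).

HONEST FRAMING (binding).  Count-neutral COMPOSITION of landed theorems by name; NO estimate of Bałaban's is proved or asserted; nothing of the record is constructed or claimed to meet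
the displayed inputs; `𝔸 : Type`.  N22 is NOT discharged (typed 28∕28 · discharged 5∕27 UNCHANGED); K3⁸ OPEN and NOT claimed (no stub of 27366 touched); NE9 is NOT IN PRINT for d = 4;
no count claim; one finite 𝕋⁴ programme at fixed ε — R4 closes the CONDITIONAL rung `BalabanLadder.UV` only; NOTHING about the continuum limit, ℝ⁴, infinite volume, OS axioms, a
mass gap or the Clay problem is proved or claimed.  References (TYPES only, no cite tags on the Summit side): [I] = Bałaban, CMP 109 (1987) Thm 1 p. 259, (0.23)–(0.24) pp. 256–257,
§1 p. 263 with (1.18), (1.20)–(1.22) p. 264, (2.12)–(2.13) p. 268, §3 p. 270, p. 282, (4.35)–(4.37) pp. 290–291, §5 p. 298; [II] = CMP 116 (1988) (1.41) p. 11, (2.13)–(2.14)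
pp. 14–15, (2.41) p. 21; King, CMP 102 (1986) Lemma 4.5 (the N18 mechanism's print).
-/

noncomputable section

open Filter Topology Set Metric
open scoped BigOperators

namespace YMDAG.N22.KernelFading

open Literature.MathematicalPhysics.QuantumFieldTheory.Balaban1983to89
open Literature.MathematicalPhysics.QuantumFieldTheory.Balaban1983to89.T4Continuum (T4Family ULoop)
open Literature.MathematicalPhysics.QuantumFieldTheory.Balaban1983to89.T4OutputRate (Window NE9)
open Literature.MathematicalPhysics.QuantumFieldTheory.Balaban1983to89.TreeLengthTorus (TPt)
open Literature.MathematicalPhysics.QuantumFieldTheory.Balaban1983to89.B12TreeDecay (K₀ kappa₀)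
open Literature.MathematicalPhysics.QuantumFieldTheory.Balaban1983to89.B12Decay510 (delta1)
open Literature.MathematicalPhysics.QuantumFieldTheory.Balaban1983to89.B12Decay510Window (K₁)
open Literature.MathematicalPhysics.QuantumFieldTheory.Balaban1983to89.B12Decay510Torus (distCT nearT)
open Literature.MathematicalPhysics.QuantumFieldTheory.Balaban1983to89.Node00 (Stage13Params Stage13HParams U3Letters₁₁ MatA)
open Literature.MathematicalPhysics.QuantumFieldTheory.Balaban1983to89.Node00.Sect2 (domSys domCount CPair)
open Literature.MathematicalPhysics.QuantumFieldTheory.Balaban1983to89.Node00.W1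
open Literature.MathematicalPhysics.QuantumFieldTheory.Balaban1983to89.Node00.LocalizedSum17 (ReadingMaps Localizes17OfRecord₁₃)
open Literature.MathematicalPhysics.QuantumFieldTheory.Balaban1983to89.Node00.U3OfKernels (histPrefix objectsOfRecord₁₃)
open Literature.MathematicalPhysics.QuantumFieldTheory.Balaban1983to89.Node00.U3KernelLetters (KernelStepRateOfRecord₁₃ PolLimitsExistOfRecord₁₃)
open YMDAG.UVSplit (N22At u3OfRecord₁₃ RateReading₁₃CoPH rateCarriersOfRecord₁₃CoPH)
open YMDAG.N22.AtKernels (n22At_rateCarriers_of_kernels_pin_of_ne9 n22At_u3OfRecord₁₃_objectsOfRecord₁₃_iff)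
open YMDAG.N22.TermRecursion (termSecondDiffAt_box_truncRun_toClusterTower_of_genStepRecursion)

open scoped Matrix.Norms.L2Operator

variable (F : T4Family) (N : ℕ) [NeZero N] {𝔸 : Type} {M : ℕ}

/-! ## §1 ★★★ K3's `h9` from node N18's kernel step rate + the one-step-map schemas on the generator towers + the output bound -/

open Classical Finset in
/-- ★★★ **K3's `h9` WITH THE RECORD's MODULI FROM NODE N18's KERNEL STEP RATE + THE ONE-STEP-MAP SCHEMAS ON node00-def-W1's GENERATOR TOWERS, READ AT THE RUN TOWERS OF RECORD —
NO SMALLNESS OF THE RECURSION's GROWTH.**  At a Stage-13 tuple `θ` (`0 < θ.γ`) with a letter block `ℓ` (`ℓ.Signs`): (N18) `KernelStepRateOfRecord₁₃ F N θ κ₅ ℓ.θ₅ C₅`; generator towers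
`Gn K` whose run towers `truncRun K (toClusterTower (Gn K))` meet W1-20's law through `emb`, with (1.21); per torus the generator schemas (G-T1), (G-T2-last), (G-T2-old) on the
admissibility domains `Adm K k` with (Adm-run), weights `0 ≤ a K k j ≤ c·ω₁^{k−j}`, `0 ≤ b K k j ≤ c_b·ω₁^{k−j}`, `lam K k ≤ ℓ₁`, `lam₂ K k ≤ ℓ₂`; rows `ω₁ + c < ν`, `(ω₁ + c)² ≤ ν`,
`1 ≤ ν`; the output bound `hbd`, term holomorphy `hEhol`, chart `hΦemb`, space clause `hΦsp`, site weights and tails at the run towers; `2κ₀(64,8) ≤ κ ≤ κ_E`; the letter rows with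
**`ℓ.θ₅·ν ≤ ℓ.ω²`** and the `C₉` row at `C₂ = (16L₂B₃²∕r²)e^{12Mδ₁}K₀K₁` ⟹ **`NE9 ((objectsOfRecord₁₃ F N θ ℓ).EA 0) (Window θ.γ) ℓ.κ ℓ.moduli`** — module J53's
`termSecondDiffAt_box_truncRun_toClusterTower_of_genStepRecursion` at every torus supplies J49 §2's `hΔ` (`M₂ := L₂`, `q := ν`) at `S := fun K => truncRun K (toClusterTower (Gn K))`.
LOCATED (hypothesis form: the schemas are UNPRINTED shapes on def-W1's generator); N22 NOT discharged. [folklore] -/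
theorem ne9_EA_objectsOfRecord₁₃_of_kernelStepRate_genStepRecursion (θ : Stage13Params F N) (ℓ : U3Letters₁₁) (hs : ℓ.Signs) (hγ : 0 < θ.γ)
    (hlim : PolLimitsExistOfRecord₁₃ F N θ) {κ₅ C₅ : ℝ} (hC₅ : 0 ≤ C₅) (h5 : KernelStepRateOfRecord₁₃ F N θ κ₅ ℓ.θ₅ C₅)
    (m' : ℕ) (M : ℕ) [NeZero M] (hM : M = F.L ^ m')
    (Gn : (K : ℕ) → GenTower (F.P K) 𝔸 M) (emb : ReadingMaps F (MatA N) 𝔸)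
    (hloc : Localizes17OfRecord₁₃ F N θ (fun K => truncRun K (toClusterTower (Gn K))) emb)
    (sp : (K k : ℕ) → (domSys (F.P K) M (k + 1)).Dom → Set (CPair (F.P K) 𝔸))
    {κ κE δ₀ B₃ r B ℓ₁ ℓ₂ c cb ω₁ ν : ℝ} {lam lam₂ : ℕ → ℕ → ℝ} {a b : ℕ → ℕ → ℕ → ℝ}
    (hκ₀ : kappa₀ (4 * 2 ^ 4) (2 * 4) ≤ κ / 2) (hδ₀ : 0 < δ₀) (hB₃ : 0 ≤ B₃) (hr : 0 < r) (hB : 0 ≤ B) (hκE : κ ≤ κE)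
    (Adm : (K k : ℕ) → OlderTerms (F.P K) 𝔸 M k → Prop)
    (hAdm : ∀ K, ∀ g ∈ Window θ.γ, ∀ k, Adm K k (olderOf (recTerm (Gn K) fun n => ((g n : ℝ) : ℂ)) k))
    (hG1 : ∀ (K k : ℕ), ∀ t ∈ Ioc (0 : ℝ) θ.γ, ∀ t' ∈ Ioc (0 : ℝ) θ.γ, ∀ (old old' : OlderTerms (F.P K) 𝔸 M k), Adm K k old → Adm K k old' → ∀ (D : ℕ → ℝ),
      (∀ (k' : ℕ) (hk' : k' < k) (Y : (domSys (F.P K) M (k' + 1)).Dom), ∀ φ' ∈ sp K k' Y,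
        ‖old ⟨k' + 1, Nat.succ_lt_succ hk'⟩ Y φ' - old' ⟨k' + 1, Nat.succ_lt_succ hk'⟩ Y φ'‖ ≤ Real.exp (-(κE * (domSys (F.P K) M (k' + 1)).dj Y)) * D (k' + 1)) →
      ∀ (X : (domSys (F.P K) M (k + 1)).Dom), ∀ φ ∈ sp K k X,
        ‖((Gn K) k).E ((t : ℝ) : ℂ) old φ X - ((Gn K) k).E ((t' : ℝ) : ℂ) old' φ X‖ ≤
          Real.exp (-(κE * (domSys (F.P K) M (k + 1)).dj X)) * (lam K k * |t - t'| + ∑ j ∈ range (k + 1), a K k j * D j))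
    (hlam : ∀ K k, lam K k ≤ ℓ₁) (hℓ₁ : 0 ≤ ℓ₁)
    (hG2last : ∀ (K k : ℕ) (old : OlderTerms (F.P K) 𝔸 M k), Adm K k old → ∀ (t d : ℝ), 0 < d → t - d ∈ Ioc (0 : ℝ) θ.γ → t + d ∈ Ioc (0 : ℝ) θ.γ →
      ∀ (X : (domSys (F.P K) M (k + 1)).Dom), ∀ φ ∈ sp K k X,
        ‖((Gn K) k).E ((t + d : ℝ) : ℂ) old φ X - 2 * ((Gn K) k).E ((t : ℝ) : ℂ) old φ X + ((Gn K) k).E ((t - d : ℝ) : ℂ) old φ X‖ ≤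
          Real.exp (-(κE * (domSys (F.P K) M (k + 1)).dj X)) * (lam₂ K k * d ^ 2))
    (hG2old : ∀ (K k : ℕ), ∀ t ∈ Ioc (0 : ℝ) θ.γ, ∀ (o₁ o₂ o₃ : OlderTerms (F.P K) 𝔸 M k), Adm K k o₁ → Adm K k o₂ → Adm K k o₃ → ∀ (D₁ D₂ : ℕ → ℝ),
      (∀ (k' : ℕ) (hk' : k' < k) (Y : (domSys (F.P K) M (k' + 1)).Dom), ∀ φ' ∈ sp K k' Y,
        ‖o₁ ⟨k' + 1, Nat.succ_lt_succ hk'⟩ Y φ' - o₂ ⟨k' + 1, Nat.succ_lt_succ hk'⟩ Y φ'‖ ≤ Real.exp (-(κE * (domSys (F.P K) M (k' + 1)).dj Y)) * D₁ (k' + 1) ∧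
        ‖o₂ ⟨k' + 1, Nat.succ_lt_succ hk'⟩ Y φ' - o₃ ⟨k' + 1, Nat.succ_lt_succ hk'⟩ Y φ'‖ ≤ Real.exp (-(κE * (domSys (F.P K) M (k' + 1)).dj Y)) * D₁ (k' + 1) ∧
        ‖o₁ ⟨k' + 1, Nat.succ_lt_succ hk'⟩ Y φ' - 2 * o₂ ⟨k' + 1, Nat.succ_lt_succ hk'⟩ Y φ' + o₃ ⟨k' + 1, Nat.succ_lt_succ hk'⟩ Y φ'‖ ≤
          Real.exp (-(κE * (domSys (F.P K) M (k' + 1)).dj Y)) * D₂ (k' + 1)) →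
      ∀ (X : (domSys (F.P K) M (k + 1)).Dom), ∀ φ ∈ sp K k X,
        ‖((Gn K) k).E ((t : ℝ) : ℂ) o₁ φ X - 2 * ((Gn K) k).E ((t : ℝ) : ℂ) o₂ φ X + ((Gn K) k).E ((t : ℝ) : ℂ) o₃ φ X‖ ≤
          Real.exp (-(κE * (domSys (F.P K) M (k + 1)).dj X)) * ∑ j ∈ range (k + 1), (a K k j * D₂ j + b K k j * D₁ j ^ 2))
    (ha : ∀ K k j, j ≤ k → 0 ≤ a K k j ∧ a K k j ≤ c * ω₁ ^ (k - j)) (hb : ∀ K k j, j ≤ k → 0 ≤ b K k j ∧ b K k j ≤ cb * ω₁ ^ (k - j))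
    (hlam₂ : ∀ K k, lam₂ K k ≤ ℓ₂) (hℓ₂ : 0 ≤ ℓ₂) (hc : 0 ≤ c) (hcb : 0 ≤ cb) (hω₁ : 0 ≤ ω₁) (hν : ω₁ + c < ν) (hμν : (ω₁ + c) ^ 2 ≤ ν) (hν1 : 1 ≤ ν)
    (hbd : ∀ g ∈ Window θ.γ, ∀ (K k : ℕ) (X : (domSys (F.P K) M (k + 1)).Dom), ∀ φ ∈ sp K k X,
      ‖(truncRun K (toClusterTower (Gn K)) k).E (histPrefix g k) φ X‖ ≤ B * Real.exp (-(κE * (domSys (F.P K) M (k + 1)).dj X)))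
    (Ec : ℕ → ℕ → Type*) [∀ K k, NormedAddCommGroup (Ec K k)] [∀ K k, NormedSpace ℂ (Ec K k)]
    (ι : letI := θ.instVβ₁; letI := θ.instVβ₂
      (K k : ℕ) → (domSys (F.P K) M (k + 1)).Dom → ((Fin (F.P K).d → Site (F.P K) (k + 1) → θ.Vβ) →L[ℝ] Ec K k))
    (Φ : (K k : ℕ) → (domSys (F.P K) M (k + 1)).Dom → Ec K k → CPair (F.P K) 𝔸)
    (U : (K k : ℕ) → (domSys (F.P K) M (k + 1)).Dom → Set (Ec K k)) (hU : ∀ K k X, IsOpen (U K k X)) (hrU : ∀ K k X, ball (0 : Ec K k) r ⊆ U K k X)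
    (hEhol : ∀ g ∈ Window θ.γ, ∀ (K k : ℕ) (X : (domSys (F.P K) M (k + 1)).Dom),
      DifferentiableOn ℂ (fun z => (truncRun K (toClusterTower (Gn K)) k).E (histPrefix g k) (Φ K k X z) X) (U K k X))
    (hΦemb : letI := θ.instVβ₁; letI := θ.instVβ₂
      ∀ (K k : ℕ) (X : (domSys (F.P K) M (k + 1)).Dom) (Bf : Fin (F.P K).d → Site (F.P K) (k + 1) → θ.Vβ),
        Φ K k X (ι K k X Bf) = emb K k (fun l t => NormedSpace.exp (θ.ρ8 (Bf l t))))
    (hΦsp : ∀ (K k : ℕ) (X : (domSys (F.P K) M (k + 1)).Dom), ∀ z ∈ ball (0 : Ec K k) r, Φ K k X z ∈ sp K k X)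
    (w : (K k : ℕ) → (domSys (F.P K) M (k + 1)).Dom → Site (F.P K) (k + 1) → ℝ) (hw₀ : ∀ K k X t, 0 ≤ w K k X t)
    (hw : letI := θ.instVβ₁; letI := θ.instVβ₂; letI := θ.instιβ
      ∀ (K k : ℕ) (X : (domSys (F.P K) M (k + 1)).Dom) (l : Fin (F.P K).d) (t : Site (F.P K) (k + 1)) (c : θ.ιβ),
        ‖ι K k X (Pi.single l (Pi.single t (θ.bV c)))‖ ≤ w K k X t)
    (htail : ∀ (K k : ℕ) (X : (domSys (F.P K) M (k + 1)).Dom) (t : Site (F.P K) (k + 1)),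
      let e : Site (F.P K) (k + 1) → TPt 4 (domCount (F.P K) M (k + 1) * M) := fun x i => (ZMod.cast (x i) : ZMod (domCount (F.P K) M (k + 1) * M))
      w K k X t ≤ B₃ * Real.exp (-δ₀ * distCT (domCount (F.P K) M (k + 1)) M (e t) (nearT (M := M) (e t) X)))
    (hκ₅ : delta1 δ₀ κ ((M : ℝ) * 4) ≤ κ₅)
    (hω : 0 < ℓ.ω) (hθω : ℓ.θ₅ * ν ≤ ℓ.ω ^ 2) (hℓκ : ℓ.κ ≤ delta1 δ₀ κ ((M : ℝ) * 4))
    (hC₉ : (4 * (2 * C₅ / (1 - ℓ.θ₅) + 2 * ((16 * B * B₃ ^ 2 / r ^ 2) * Real.exp (delta1 δ₀ κ ((M : ℝ) * 4) * ((M : ℝ) * 4) * 3) * K₀ (4 * 2 ^ 4) (2 * 4) * K₁ 4 (δ₀ / 2))) / θ.γ +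
        ((16 * max ℓ₂ (cb * ℓ₁ ^ 2 / (ν - ω₁ - c)) * B₃ ^ 2 / r ^ 2) * Real.exp (delta1 δ₀ κ ((M : ℝ) * 4) * ((M : ℝ) * 4) * 3) * K₀ (4 * 2 ^ 4) (2 * 4) *
          K₁ 4 (δ₀ / 2)) * θ.γ / 2) / ℓ.ω ≤ ℓ.C₉) :
    NE9 ((objectsOfRecord₁₃ F N θ ℓ).EA 0) (Window θ.γ) ℓ.κ ℓ.moduli := by
  have hL₂ : 0 ≤ max ℓ₂ (cb * ℓ₁ ^ 2 / (ν - ω₁ - c)) := hℓ₂.trans (le_max_left _ _)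
  -- module J53 at every torus: the term-level letter `hΔ` for the run towers (tables non-empty through the chart at `z = 0`)
  have hsp : ∀ (K k : ℕ) (X : (domSys (F.P K) M (k + 1)).Dom), (sp K k X).Nonempty := fun K k X => ⟨Φ K k X 0, hΦsp K k X 0 (mem_ball_self hr)⟩
  have hΔ : ∀ (K k : ℕ) (i : Fin (k + 1)), ∀ g ∈ box θ.γ k, ∀ (X : (domSys (F.P K) M (k + 1)).Dom), ∀ φ ∈ sp K k X, ∀ t d : ℝ, 0 < d →
      t - d ∈ Ioc (0 : ℝ) θ.γ → t + d ∈ Ioc (0 : ℝ) θ.γ →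
        ‖(truncRun K (toClusterTower (Gn K)) k).E (Function.update g i (t + d)) φ X - 2 * (truncRun K (toClusterTower (Gn K)) k).E (Function.update g i t) φ X +
            (truncRun K (toClusterTower (Gn K)) k).E (Function.update g i (t - d)) φ X‖ ≤
          max ℓ₂ (cb * ℓ₁ ^ 2 / (ν - ω₁ - c)) * ν ^ (k - (i : ℕ)) * Real.exp (-(κE * (domSys (F.P K) M (k + 1)).dj X)) * d ^ 2 := fun K =>
    termSecondDiffAt_box_truncRun_toClusterTower_of_genStepRecursion (Gn K) (sp K) (Adm K) (hsp K) hγ (hAdm K) (hG1 K) (hlam K) hℓ₁ (hG2last K) (hG2old K)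
      (ha K) (hb K) (hlam₂ K) hℓ₂ hc hcb hω₁ hν hμν K
  exact ne9_EA_objectsOfRecord₁₃_of_kernelStepRate_termSecondDiffGrowing_outputBound F N θ ℓ hs hγ hlim hC₅ h5 m' M hM (fun K => truncRun K (toClusterTower (Gn K))) emb hloc
    sp hκ₀ hδ₀ hB₃ hr hL₂ hν1 hB hκE hΔ hbd Ec ι Φ U hU hrU hEhol hΦemb hΦsp w hw₀ hw htail hκ₅ hω hθω hℓκ hC₉

/-! ## §2 ★★★ The kernel-face socket in generator currency -/

open Classical Finset in
/-- ★★★ **THE KERNEL-FACE SOCKET EDITION IN GENERATOR CURRENCY** — §1's inputs ⟹ **`N22At (u3OfRecord₁₃ θ (objectsOfRecord₁₃ F N θ ℓ) k)` for EVERY run length `k`** (dag-n27-c's `h22` row of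
the `…KernelFaces` leaf), by dag-n22-w3's level-free `n22At_u3OfRecord₁₃_objectsOfRecord₁₃_iff` on §1.  LOCATED (hypothesis form); N22 NOT discharged. [folklore] -/
theorem n22At_u3OfRecord₁₃_of_kernelStepRate_genStepRecursion (θ : Stage13Params F N) (ℓ : U3Letters₁₁) (hs : ℓ.Signs) (hγ : 0 < θ.γ)
    (hlim : PolLimitsExistOfRecord₁₃ F N θ) {κ₅ C₅ : ℝ} (hC₅ : 0 ≤ C₅) (h5 : KernelStepRateOfRecord₁₃ F N θ κ₅ ℓ.θ₅ C₅)
    (m' : ℕ) (M : ℕ) [NeZero M] (hM : M = F.L ^ m')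
    (Gn : (K : ℕ) → GenTower (F.P K) 𝔸 M) (emb : ReadingMaps F (MatA N) 𝔸)
    (hloc : Localizes17OfRecord₁₃ F N θ (fun K => truncRun K (toClusterTower (Gn K))) emb)
    (sp : (K k : ℕ) → (domSys (F.P K) M (k + 1)).Dom → Set (CPair (F.P K) 𝔸))
    {κ κE δ₀ B₃ r B ℓ₁ ℓ₂ c cb ω₁ ν : ℝ} {lam lam₂ : ℕ → ℕ → ℝ} {a b : ℕ → ℕ → ℕ → ℝ}
    (hκ₀ : kappa₀ (4 * 2 ^ 4) (2 * 4) ≤ κ / 2) (hδ₀ : 0 < δ₀) (hB₃ : 0 ≤ B₃) (hr : 0 < r) (hB : 0 ≤ B) (hκE : κ ≤ κE)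
    (Adm : (K k : ℕ) → OlderTerms (F.P K) 𝔸 M k → Prop)
    (hAdm : ∀ K, ∀ g ∈ Window θ.γ, ∀ k, Adm K k (olderOf (recTerm (Gn K) fun n => ((g n : ℝ) : ℂ)) k))
    (hG1 : ∀ (K k : ℕ), ∀ t ∈ Ioc (0 : ℝ) θ.γ, ∀ t' ∈ Ioc (0 : ℝ) θ.γ, ∀ (old old' : OlderTerms (F.P K) 𝔸 M k), Adm K k old → Adm K k old' → ∀ (D : ℕ → ℝ),
      (∀ (k' : ℕ) (hk' : k' < k) (Y : (domSys (F.P K) M (k' + 1)).Dom), ∀ φ' ∈ sp K k' Y,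
        ‖old ⟨k' + 1, Nat.succ_lt_succ hk'⟩ Y φ' - old' ⟨k' + 1, Nat.succ_lt_succ hk'⟩ Y φ'‖ ≤ Real.exp (-(κE * (domSys (F.P K) M (k' + 1)).dj Y)) * D (k' + 1)) →
      ∀ (X : (domSys (F.P K) M (k + 1)).Dom), ∀ φ ∈ sp K k X,
        ‖((Gn K) k).E ((t : ℝ) : ℂ) old φ X - ((Gn K) k).E ((t' : ℝ) : ℂ) old' φ X‖ ≤
          Real.exp (-(κE * (domSys (F.P K) M (k + 1)).dj X)) * (lam K k * |t - t'| + ∑ j ∈ range (k + 1), a K k j * D j))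
    (hlam : ∀ K k, lam K k ≤ ℓ₁) (hℓ₁ : 0 ≤ ℓ₁)
    (hG2last : ∀ (K k : ℕ) (old : OlderTerms (F.P K) 𝔸 M k), Adm K k old → ∀ (t d : ℝ), 0 < d → t - d ∈ Ioc (0 : ℝ) θ.γ → t + d ∈ Ioc (0 : ℝ) θ.γ →
      ∀ (X : (domSys (F.P K) M (k + 1)).Dom), ∀ φ ∈ sp K k X,
        ‖((Gn K) k).E ((t + d : ℝ) : ℂ) old φ X - 2 * ((Gn K) k).E ((t : ℝ) : ℂ) old φ X + ((Gn K) k).E ((t - d : ℝ) : ℂ) old φ X‖ ≤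
          Real.exp (-(κE * (domSys (F.P K) M (k + 1)).dj X)) * (lam₂ K k * d ^ 2))
    (hG2old : ∀ (K k : ℕ), ∀ t ∈ Ioc (0 : ℝ) θ.γ, ∀ (o₁ o₂ o₃ : OlderTerms (F.P K) 𝔸 M k), Adm K k o₁ → Adm K k o₂ → Adm K k o₃ → ∀ (D₁ D₂ : ℕ → ℝ),
      (∀ (k' : ℕ) (hk' : k' < k) (Y : (domSys (F.P K) M (k' + 1)).Dom), ∀ φ' ∈ sp K k' Y,
        ‖o₁ ⟨k' + 1, Nat.succ_lt_succ hk'⟩ Y φ' - o₂ ⟨k' + 1, Nat.succ_lt_succ hk'⟩ Y φ'‖ ≤ Real.exp (-(κE * (domSys (F.P K) M (k' + 1)).dj Y)) * D₁ (k' + 1) ∧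
        ‖o₂ ⟨k' + 1, Nat.succ_lt_succ hk'⟩ Y φ' - o₃ ⟨k' + 1, Nat.succ_lt_succ hk'⟩ Y φ'‖ ≤ Real.exp (-(κE * (domSys (F.P K) M (k' + 1)).dj Y)) * D₁ (k' + 1) ∧
        ‖o₁ ⟨k' + 1, Nat.succ_lt_succ hk'⟩ Y φ' - 2 * o₂ ⟨k' + 1, Nat.succ_lt_succ hk'⟩ Y φ' + o₃ ⟨k' + 1, Nat.succ_lt_succ hk'⟩ Y φ'‖ ≤
          Real.exp (-(κE * (domSys (F.P K) M (k' + 1)).dj Y)) * D₂ (k' + 1)) →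
      ∀ (X : (domSys (F.P K) M (k + 1)).Dom), ∀ φ ∈ sp K k X,
        ‖((Gn K) k).E ((t : ℝ) : ℂ) o₁ φ X - 2 * ((Gn K) k).E ((t : ℝ) : ℂ) o₂ φ X + ((Gn K) k).E ((t : ℝ) : ℂ) o₃ φ X‖ ≤
          Real.exp (-(κE * (domSys (F.P K) M (k + 1)).dj X)) * ∑ j ∈ range (k + 1), (a K k j * D₂ j + b K k j * D₁ j ^ 2))
    (ha : ∀ K k j, j ≤ k → 0 ≤ a K k j ∧ a K k j ≤ c * ω₁ ^ (k - j)) (hb : ∀ K k j, j ≤ k → 0 ≤ b K k j ∧ b K k j ≤ cb * ω₁ ^ (k - j))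
    (hlam₂ : ∀ K k, lam₂ K k ≤ ℓ₂) (hℓ₂ : 0 ≤ ℓ₂) (hc : 0 ≤ c) (hcb : 0 ≤ cb) (hω₁ : 0 ≤ ω₁) (hν : ω₁ + c < ν) (hμν : (ω₁ + c) ^ 2 ≤ ν) (hν1 : 1 ≤ ν)
    (hbd : ∀ g ∈ Window θ.γ, ∀ (K k : ℕ) (X : (domSys (F.P K) M (k + 1)).Dom), ∀ φ ∈ sp K k X,
      ‖(truncRun K (toClusterTower (Gn K)) k).E (histPrefix g k) φ X‖ ≤ B * Real.exp (-(κE * (domSys (F.P K) M (k + 1)).dj X)))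
    (Ec : ℕ → ℕ → Type*) [∀ K k, NormedAddCommGroup (Ec K k)] [∀ K k, NormedSpace ℂ (Ec K k)]
    (ι : letI := θ.instVβ₁; letI := θ.instVβ₂
      (K k : ℕ) → (domSys (F.P K) M (k + 1)).Dom → ((Fin (F.P K).d → Site (F.P K) (k + 1) → θ.Vβ) →L[ℝ] Ec K k))
    (Φ : (K k : ℕ) → (domSys (F.P K) M (k + 1)).Dom → Ec K k → CPair (F.P K) 𝔸)
    (U : (K k : ℕ) → (domSys (F.P K) M (k + 1)).Dom → Set (Ec K k)) (hU : ∀ K k X, IsOpen (U K k X)) (hrU : ∀ K k X, ball (0 : Ec K k) r ⊆ U K k X)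
    (hEhol : ∀ g ∈ Window θ.γ, ∀ (K k : ℕ) (X : (domSys (F.P K) M (k + 1)).Dom),
      DifferentiableOn ℂ (fun z => (truncRun K (toClusterTower (Gn K)) k).E (histPrefix g k) (Φ K k X z) X) (U K k X))
    (hΦemb : letI := θ.instVβ₁; letI := θ.instVβ₂
      ∀ (K k : ℕ) (X : (domSys (F.P K) M (k + 1)).Dom) (Bf : Fin (F.P K).d → Site (F.P K) (k + 1) → θ.Vβ),
        Φ K k X (ι K k X Bf) = emb K k (fun l t => NormedSpace.exp (θ.ρ8 (Bf l t))))
    (hΦsp : ∀ (K k : ℕ) (X : (domSys (F.P K) M (k + 1)).Dom), ∀ z ∈ ball (0 : Ec K k) r, Φ K k X z ∈ sp K k X)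
    (w : (K k : ℕ) → (domSys (F.P K) M (k + 1)).Dom → Site (F.P K) (k + 1) → ℝ) (hw₀ : ∀ K k X t, 0 ≤ w K k X t)
    (hw : letI := θ.instVβ₁; letI := θ.instVβ₂; letI := θ.instιβ
      ∀ (K k : ℕ) (X : (domSys (F.P K) M (k + 1)).Dom) (l : Fin (F.P K).d) (t : Site (F.P K) (k + 1)) (c : θ.ιβ),
        ‖ι K k X (Pi.single l (Pi.single t (θ.bV c)))‖ ≤ w K k X t)
    (htail : ∀ (K k : ℕ) (X : (domSys (F.P K) M (k + 1)).Dom) (t : Site (F.P K) (k + 1)),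
      let e : Site (F.P K) (k + 1) → TPt 4 (domCount (F.P K) M (k + 1) * M) := fun x i => (ZMod.cast (x i) : ZMod (domCount (F.P K) M (k + 1) * M))
      w K k X t ≤ B₃ * Real.exp (-δ₀ * distCT (domCount (F.P K) M (k + 1)) M (e t) (nearT (M := M) (e t) X)))
    (hκ₅ : delta1 δ₀ κ ((M : ℝ) * 4) ≤ κ₅)
    (hω : 0 < ℓ.ω) (hθω : ℓ.θ₅ * ν ≤ ℓ.ω ^ 2) (hℓκ : ℓ.κ ≤ delta1 δ₀ κ ((M : ℝ) * 4))
    (hC₉ : (4 * (2 * C₅ / (1 - ℓ.θ₅) + 2 * ((16 * B * B₃ ^ 2 / r ^ 2) * Real.exp (delta1 δ₀ κ ((M : ℝ) * 4) * ((M : ℝ) * 4) * 3) * K₀ (4 * 2 ^ 4) (2 * 4) * K₁ 4 (δ₀ / 2))) / θ.γ +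
        ((16 * max ℓ₂ (cb * ℓ₁ ^ 2 / (ν - ω₁ - c)) * B₃ ^ 2 / r ^ 2) * Real.exp (delta1 δ₀ κ ((M : ℝ) * 4) * ((M : ℝ) * 4) * 3) * K₀ (4 * 2 ^ 4) (2 * 4) *
          K₁ 4 (δ₀ / 2)) * θ.γ / 2) / ℓ.ω ≤ ℓ.C₉) (k : ℕ) :
    N22At (u3OfRecord₁₃ θ (objectsOfRecord₁₃ F N θ ℓ) k) :=
  (n22At_u3OfRecord₁₃_objectsOfRecord₁₃_iff F N θ ℓ hs k).2
    (ne9_EA_objectsOfRecord₁₃_of_kernelStepRate_genStepRecursion F N θ ℓ hs hγ hlim hC₅ h5 m' M hM Gn emb hloc sp hκ₀ hδ₀ hB₃ hr hB hκE Adm hAdm hG1 hlam hℓ₁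
      hG2last hG2old ha hb hlam₂ hℓ₂ hc hcb hω₁ hν hμν hν1 hbd Ec ι Φ U hU hrU hEhol hΦemb hΦsp w hw₀ hw htail hκ₅ hω hθω hℓκ hC₉)

/-! ## §3 ★★★ The N22 pin face in generator currency -/

open Classical Finset in
/-- ★★★ **THE N22 PIN FACE IN GENERATOR CURRENCY**: under K3's node-U3 pin at the tuple (`hpin`), §1's inputs at `θ.toStage13Params` give `N22At (rateCarriersOfRecord₁₃CoPH 𝔯 F θ hP g₀ os k).u3`
for EVERY run length `k` — dag-n22-w3's pin form fed with §1.  THE N22 ROW SENTENCE in this currency: «node N18's kernel step rate of record + first- and second-order Lipschitz structure of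
def-W1's one-step map {last coupling, older terms} ↦ new term on every torus (admissibility domain, generated runs admissible, geometrically weighted channels) + the printed-type output
bound + term holomorphy through the readings + tails + W1-20's law at the run towers + (1.21) + letter rows with `ℓ.θ₅·ν ≤ ℓ.ω²` ⇒ §2b `h9` ∕ `N22At` — NO smallness of the
recursion's growth».  LOCATED (hypothesis form); N22 NOT discharged. [folklore] -/
theorem n22At_rateCarriers_of_kernels_pin_of_kernelStepRate_genStepRecursion (𝔯 : RateReading₁₃CoPH N) (θ : Stage13HParams F N) (hP : θ.Provisos₁₃CoPH F N)
    (g₀ : ℕ → ℝ) (os : List (ULoop F)) (ℓ : U3Letters₁₁) (hs : ℓ.Signs) (hγ : 0 < θ.γ)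
    (hpin : (𝔯.lit F θ hP g₀ os).u3 = objectsOfRecord₁₃ F N θ.toStage13Params ℓ)
    (hlim : PolLimitsExistOfRecord₁₃ F N θ.toStage13Params) {κ₅ C₅ : ℝ} (hC₅ : 0 ≤ C₅) (h5 : KernelStepRateOfRecord₁₃ F N θ.toStage13Params κ₅ ℓ.θ₅ C₅)
    (m' : ℕ) (M : ℕ) [NeZero M] (hM : M = F.L ^ m')
    (Gn : (K : ℕ) → GenTower (F.P K) 𝔸 M) (emb : ReadingMaps F (MatA N) 𝔸) (hloc : Localizes17OfRecord₁₃ F N θ.toStage13Params (fun K => truncRun K (toClusterTower (Gn K))) emb)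
    (sp : (K k : ℕ) → (domSys (F.P K) M (k + 1)).Dom → Set (CPair (F.P K) 𝔸))
    {κ κE δ₀ B₃ r B ℓ₁ ℓ₂ c cb ω₁ ν : ℝ} {lam lam₂ : ℕ → ℕ → ℝ} {a b : ℕ → ℕ → ℕ → ℝ}
    (hκ₀ : kappa₀ (4 * 2 ^ 4) (2 * 4) ≤ κ / 2) (hδ₀ : 0 < δ₀) (hB₃ : 0 ≤ B₃) (hr : 0 < r) (hB : 0 ≤ B) (hκE : κ ≤ κE)
    (Adm : (K k : ℕ) → OlderTerms (F.P K) 𝔸 M k → Prop)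
    (hAdm : ∀ K, ∀ g ∈ Window θ.γ, ∀ k, Adm K k (olderOf (recTerm (Gn K) fun n => ((g n : ℝ) : ℂ)) k))
    (hG1 : ∀ (K k : ℕ), ∀ t ∈ Ioc (0 : ℝ) θ.γ, ∀ t' ∈ Ioc (0 : ℝ) θ.γ, ∀ (old old' : OlderTerms (F.P K) 𝔸 M k), Adm K k old → Adm K k old' → ∀ (D : ℕ → ℝ),
      (∀ (k' : ℕ) (hk' : k' < k) (Y : (domSys (F.P K) M (k' + 1)).Dom), ∀ φ' ∈ sp K k' Y,
        ‖old ⟨k' + 1, Nat.succ_lt_succ hk'⟩ Y φ' - old' ⟨k' + 1, Nat.succ_lt_succ hk'⟩ Y φ'‖ ≤ Real.exp (-(κE * (domSys (F.P K) M (k' + 1)).dj Y)) * D (k' + 1)) →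
      ∀ (X : (domSys (F.P K) M (k + 1)).Dom), ∀ φ ∈ sp K k X,
        ‖((Gn K) k).E ((t : ℝ) : ℂ) old φ X - ((Gn K) k).E ((t' : ℝ) : ℂ) old' φ X‖ ≤
          Real.exp (-(κE * (domSys (F.P K) M (k + 1)).dj X)) * (lam K k * |t - t'| + ∑ j ∈ range (k + 1), a K k j * D j))
    (hlam : ∀ K k, lam K k ≤ ℓ₁) (hℓ₁ : 0 ≤ ℓ₁)
    (hG2last : ∀ (K k : ℕ) (old : OlderTerms (F.P K) 𝔸 M k), Adm K k old → ∀ (t d : ℝ), 0 < d → t - d ∈ Ioc (0 : ℝ) θ.γ → t + d ∈ Ioc (0 : ℝ) θ.γ →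
      ∀ (X : (domSys (F.P K) M (k + 1)).Dom), ∀ φ ∈ sp K k X,
        ‖((Gn K) k).E ((t + d : ℝ) : ℂ) old φ X - 2 * ((Gn K) k).E ((t : ℝ) : ℂ) old φ X + ((Gn K) k).E ((t - d : ℝ) : ℂ) old φ X‖ ≤
          Real.exp (-(κE * (domSys (F.P K) M (k + 1)).dj X)) * (lam₂ K k * d ^ 2))
    (hG2old : ∀ (K k : ℕ), ∀ t ∈ Ioc (0 : ℝ) θ.γ, ∀ (o₁ o₂ o₃ : OlderTerms (F.P K) 𝔸 M k), Adm K k o₁ → Adm K k o₂ → Adm K k o₃ → ∀ (D₁ D₂ : ℕ → ℝ),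
      (∀ (k' : ℕ) (hk' : k' < k) (Y : (domSys (F.P K) M (k' + 1)).Dom), ∀ φ' ∈ sp K k' Y,
        ‖o₁ ⟨k' + 1, Nat.succ_lt_succ hk'⟩ Y φ' - o₂ ⟨k' + 1, Nat.succ_lt_succ hk'⟩ Y φ'‖ ≤ Real.exp (-(κE * (domSys (F.P K) M (k' + 1)).dj Y)) * D₁ (k' + 1) ∧
        ‖o₂ ⟨k' + 1, Nat.succ_lt_succ hk'⟩ Y φ' - o₃ ⟨k' + 1, Nat.succ_lt_succ hk'⟩ Y φ'‖ ≤ Real.exp (-(κE * (domSys (F.P K) M (k' + 1)).dj Y)) * D₁ (k' + 1) ∧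
        ‖o₁ ⟨k' + 1, Nat.succ_lt_succ hk'⟩ Y φ' - 2 * o₂ ⟨k' + 1, Nat.succ_lt_succ hk'⟩ Y φ' + o₃ ⟨k' + 1, Nat.succ_lt_succ hk'⟩ Y φ'‖ ≤
          Real.exp (-(κE * (domSys (F.P K) M (k' + 1)).dj Y)) * D₂ (k' + 1)) →
      ∀ (X : (domSys (F.P K) M (k + 1)).Dom), ∀ φ ∈ sp K k X,
        ‖((Gn K) k).E ((t : ℝ) : ℂ) o₁ φ X - 2 * ((Gn K) k).E ((t : ℝ) : ℂ) o₂ φ X + ((Gn K) k).E ((t : ℝ) : ℂ) o₃ φ X‖ ≤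
          Real.exp (-(κE * (domSys (F.P K) M (k + 1)).dj X)) * ∑ j ∈ range (k + 1), (a K k j * D₂ j + b K k j * D₁ j ^ 2))
    (ha : ∀ K k j, j ≤ k → 0 ≤ a K k j ∧ a K k j ≤ c * ω₁ ^ (k - j)) (hb : ∀ K k j, j ≤ k → 0 ≤ b K k j ∧ b K k j ≤ cb * ω₁ ^ (k - j))
    (hlam₂ : ∀ K k, lam₂ K k ≤ ℓ₂) (hℓ₂ : 0 ≤ ℓ₂) (hc : 0 ≤ c) (hcb : 0 ≤ cb) (hω₁ : 0 ≤ ω₁) (hν : ω₁ + c < ν) (hμν : (ω₁ + c) ^ 2 ≤ ν) (hν1 : 1 ≤ ν)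
    (hbd : ∀ g ∈ Window θ.γ, ∀ (K k : ℕ) (X : (domSys (F.P K) M (k + 1)).Dom), ∀ φ ∈ sp K k X,
      ‖(truncRun K (toClusterTower (Gn K)) k).E (histPrefix g k) φ X‖ ≤ B * Real.exp (-(κE * (domSys (F.P K) M (k + 1)).dj X)))
    (Ec : ℕ → ℕ → Type*) [∀ K k, NormedAddCommGroup (Ec K k)] [∀ K k, NormedSpace ℂ (Ec K k)]
    (ι : letI := θ.instVβ₁; letI := θ.instVβ₂
      (K k : ℕ) → (domSys (F.P K) M (k + 1)).Dom → ((Fin (F.P K).d → Site (F.P K) (k + 1) → θ.Vβ) →L[ℝ] Ec K k))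
    (Φ : (K k : ℕ) → (domSys (F.P K) M (k + 1)).Dom → Ec K k → CPair (F.P K) 𝔸)
    (U : (K k : ℕ) → (domSys (F.P K) M (k + 1)).Dom → Set (Ec K k)) (hU : ∀ K k X, IsOpen (U K k X)) (hrU : ∀ K k X, ball (0 : Ec K k) r ⊆ U K k X)
    (hEhol : ∀ g ∈ Window θ.γ, ∀ (K k : ℕ) (X : (domSys (F.P K) M (k + 1)).Dom),
      DifferentiableOn ℂ (fun z => (truncRun K (toClusterTower (Gn K)) k).E (histPrefix g k) (Φ K k X z) X) (U K k X))
    (hΦemb : letI := θ.instVβ₁; letI := θ.instVβ₂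
      ∀ (K k : ℕ) (X : (domSys (F.P K) M (k + 1)).Dom) (Bf : Fin (F.P K).d → Site (F.P K) (k + 1) → θ.Vβ),
        Φ K k X (ι K k X Bf) = emb K k (fun l t => NormedSpace.exp (θ.ρ8 (Bf l t))))
    (hΦsp : ∀ (K k : ℕ) (X : (domSys (F.P K) M (k + 1)).Dom), ∀ z ∈ ball (0 : Ec K k) r, Φ K k X z ∈ sp K k X)
    (w : (K k : ℕ) → (domSys (F.P K) M (k + 1)).Dom → Site (F.P K) (k + 1) → ℝ) (hw₀ : ∀ K k X t, 0 ≤ w K k X t)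
    (hw : letI := θ.instVβ₁; letI := θ.instVβ₂; letI := θ.instιβ
      ∀ (K k : ℕ) (X : (domSys (F.P K) M (k + 1)).Dom) (l : Fin (F.P K).d) (t : Site (F.P K) (k + 1)) (c : θ.ιβ),
        ‖ι K k X (Pi.single l (Pi.single t (θ.bV c)))‖ ≤ w K k X t)
    (htail : ∀ (K k : ℕ) (X : (domSys (F.P K) M (k + 1)).Dom) (t : Site (F.P K) (k + 1)),
      let e : Site (F.P K) (k + 1) → TPt 4 (domCount (F.P K) M (k + 1) * M) := fun x i => (ZMod.cast (x i) : ZMod (domCount (F.P K) M (k + 1) * M))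
      w K k X t ≤ B₃ * Real.exp (-δ₀ * distCT (domCount (F.P K) M (k + 1)) M (e t) (nearT (M := M) (e t) X)))
    (hκ₅ : delta1 δ₀ κ ((M : ℝ) * 4) ≤ κ₅)
    (hω : 0 < ℓ.ω) (hθω : ℓ.θ₅ * ν ≤ ℓ.ω ^ 2) (hℓκ : ℓ.κ ≤ delta1 δ₀ κ ((M : ℝ) * 4))
    (hC₉ : (4 * (2 * C₅ / (1 - ℓ.θ₅) + 2 * ((16 * B * B₃ ^ 2 / r ^ 2) * Real.exp (delta1 δ₀ κ ((M : ℝ) * 4) * ((M : ℝ) * 4) * 3) * K₀ (4 * 2 ^ 4) (2 * 4) * K₁ 4 (δ₀ / 2))) / θ.γ +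
        ((16 * max ℓ₂ (cb * ℓ₁ ^ 2 / (ν - ω₁ - c)) * B₃ ^ 2 / r ^ 2) * Real.exp (delta1 δ₀ κ ((M : ℝ) * 4) * ((M : ℝ) * 4) * 3) * K₀ (4 * 2 ^ 4) (2 * 4) *
          K₁ 4 (δ₀ / 2)) * θ.γ / 2) / ℓ.ω ≤ ℓ.C₉) (k : ℕ) :
    N22At (rateCarriersOfRecord₁₃CoPH 𝔯 F θ hP g₀ os k).u3 :=
  n22At_rateCarriers_of_kernels_pin_of_ne9 𝔯 θ hP g₀ os ℓ hs hpin
    (ne9_EA_objectsOfRecord₁₃_of_kernelStepRate_genStepRecursion F N θ.toStage13Params ℓ hs hγ hlim hC₅ h5 m' M hM Gn emb hloc sp hκ₀ hδ₀ hB₃ hr hB hκE Adm hAdm hG1 hlam hℓ₁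
      hG2last hG2old ha hb hlam₂ hℓ₂ hc hcb hω₁ hν hμν hν1 hbd Ec ι Φ U hU hrU hEhol hΦemb hΦsp w hw₀ hw htail hκ₅ hω hθω hℓκ hC₉) k

end YMDAG.N22.KernelFading

end
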